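import Summits.Ventures.HodgeRepro2.T5SmithFractionField
import Summits.Ventures.HodgeRepro2.T5HeckeGelfandTrickGeneral

/-!
# The transpose condition of Gelfand's trick for `GL_n` over the fraction field of a PID

Tier-5 kernel support (blind cell pub-hodge-repro2, seat p8, gen 11). Closes, for the split
places of the record (`GL_n(F_v)` with `K = GL_n(𝒪_v)`) and in fact over any principal ideal
domain `R` with fraction field `F`, the «stays prose» cell of CHECK-N3 §17.1 row 5 / §18.1 row 1:
*the double-coset condition for the specific `K` — the transpose for `GL_n`*.

`T5HeckeGelfandTrickGeneral.mul_comm_of_antiAut` (T5-84) proves that `H(G, K)` is commutative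
once an anti-automorphism `τ : G ≃* Gᵐᵒᵖ` satisfies `τ(K) = K` and `τ(x) ∈ K x K` for every `x`
(all `KgK/K` finite). Here `G = GL ι F`, `τ = transposition` and the condition `xᵀ ∈ K x K`
follows from the Cartan decomposition `x = k₁ · diag(a) · k₂` of `T5SmithFractionField`:
`xᵀ = k₂ᵀ · diag(a) · k₁ᵀ = (k₂ᵀ k₁⁻¹) · x · (k₂⁻¹ k₁ᵀ)`.

* `transposeAntiAut : GL ι A ≃* (GL ι A)ᵐᵒᵖ` — `x ↦ op xᵀ` (Mathlib's `Matrix.transposeRingEquiv`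
  through `Units.mapEquiv` and `Units.opEquiv`); `transposeUnit x := unop (transposeAntiAut x)`;
* `coe_transposeUnit`, `transposeUnit_transposeUnit`, `transposeUnit_mul`, `map_transposeUnit`;
* `transposeUnit_mem_range_iff` — `K = GL_n(R)` is stable under transposition;
* `transposeUnit_eq_mul_mul` — **`xᵀ ∈ K x K`** for every `x ∈ GL_n(F)`;
* `unop_transposeAntiAut_mem_orbit` — the same in the orbit form T5-84 takes;
* `heckeAlgebra_mul_comm` — **`H(GL_n(F), GL_n(R))` is commutative** (T5-84 instantiated),
  modulo only the finiteness of every `KgK/K` (for `GL_n(𝒪_v)` this is the compactness of `K`,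
  which stays a hypothesis here).

Hypotheses as stated in the kernel: `R` a commutative domain with `IsPrincipalIdealRing R`; `F` a
field with `[Algebra R F] [IsFractionRing R F]`; `ι` a finite type with decidable equality; `k`
the coefficient field of the Hecke algebra; `hfin : ∀ g, Finite (MulAction.orbit K ↑g)`.
-/

namespace Summit.Ventures.HodgeRepro2.T5CartanTransposeGelfand

open Matrix MulOpposite

section Transpose

variable {A : Type*} [CommRing A] {ι : Type*} [Fintype ι] [DecidableEq ι]

/-- Transposition as an anti-automorphism of `GL ι A`: `x ↦ op xᵀ`. -/
def transposeAntiAut : GL ι A ≃* (GL ι A)ᵐᵒᵖ :=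
  (Units.mapEquiv (Matrix.transposeRingEquiv ι A).toMulEquiv).trans Units.opEquiv

/-- The transpose of an invertible matrix, as an invertible matrix. -/
def transposeUnit (x : GL ι A) : GL ι A := unop (transposeAntiAut x)

/-- The matrix underlying `transposeUnit x` is the transpose of the matrix underlying `x`. -/
@[simp] theorem coe_transposeUnit (x : GL ι A) :
    (transposeUnit x : Matrix ι ι A) = (x : Matrix ι ι A).transpose := rfl

/-- `unop ∘ transposeAntiAut = transposeUnit`. -/
@[simp] theorem unop_transposeAntiAut (x : GL ι A) : unop (transposeAntiAut x) = transposeUnit x :=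
  rfl

/-- Transposition is an involution on `GL ι A`. -/
@[simp] theorem transposeUnit_transposeUnit (x : GL ι A) : transposeUnit (transposeUnit x) = x := by
  ext1
  rw [coe_transposeUnit, coe_transposeUnit, Matrix.transpose_transpose]

/-- `(xy)ᵀ = yᵀ xᵀ` in `GL ι A`. -/
theorem transposeUnit_mul (x y : GL ι A) :
    transposeUnit (x * y) = transposeUnit y * transposeUnit x := by
  ext1
  rw [coe_transposeUnit, Units.val_mul, Units.val_mul, coe_transposeUnit, coe_transposeUnit,
    Matrix.transpose_mul]

/-- Transposition commutes with the entrywise image under a ring homomorphism. -/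
theorem map_transposeUnit {B : Type*} [CommRing B] (f : A →+* B) (x : GL ι A) :
    Matrix.GeneralLinearGroup.map f (transposeUnit x) =
      transposeUnit (Matrix.GeneralLinearGroup.map f x) := by
  ext i j
  rw [Matrix.GeneralLinearGroup.map_apply, coe_transposeUnit, coe_transposeUnit,
    Matrix.transpose_apply, Matrix.transpose_apply, Matrix.GeneralLinearGroup.map_apply]

end Transpose

section Integral

variable {R : Type*} [CommRing R] {F : Type*} [Field F] [Algebra R F]
variable {ι : Type*} [Fintype ι] [DecidableEq ι]

/-- The subgroup `K = GL_n(R)` of `GL_n(F)` is stable under transposition. -/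
theorem transposeUnit_mem_range_iff (x : GL ι F) :
    transposeUnit x ∈ (Matrix.GeneralLinearGroup.map (n := ι) (algebraMap R F)).range ↔
      x ∈ (Matrix.GeneralLinearGroup.map (n := ι) (algebraMap R F)).range := by
  constructor
  · rintro ⟨P, hP⟩
    refine ⟨transposeUnit P, ?_⟩
    rw [map_transposeUnit, hP, transposeUnit_transposeUnit]
  · rintro ⟨P, hP⟩
    exact ⟨transposeUnit P, by rw [map_transposeUnit, hP]⟩

/-- The first hypothesis of T5-84 for `τ = transposeAntiAut` and `K = GL_n(R)`: `τ(K) = K`. -/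
theorem unop_transposeAntiAut_mem_iff (x : GL ι F) :
    unop (transposeAntiAut x) ∈ (Matrix.GeneralLinearGroup.map (n := ι) (algebraMap R F)).range ↔
      x ∈ (Matrix.GeneralLinearGroup.map (n := ι) (algebraMap R F)).range :=
  transposeUnit_mem_range_iff x

variable [IsDomain R] [IsFractionRing R F] [IsPrincipalIdealRing R]

/-- **The transpose condition**: `xᵀ ∈ K x K` for every `x ∈ GL_n(F)`, `K = GL_n(R)` — from the
Cartan decomposition `x = k₁ · diag(a) · k₂`: `xᵀ = (k₂ᵀ k₁⁻¹) · x · (k₂⁻¹ k₁ᵀ)`. -/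
theorem transposeUnit_eq_mul_mul (x : GL ι F) :
    ∃ k₁ ∈ (Matrix.GeneralLinearGroup.map (n := ι) (algebraMap R F)).range,
      ∃ k₂ ∈ (Matrix.GeneralLinearGroup.map (n := ι) (algebraMap R F)).range,
        transposeUnit x = k₁ * x * k₂ := by
  obtain ⟨k₁, hk₁, k₂, hk₂, a, -, hx⟩ :=
    T5SmithFractionField.exists_cartan_diagonal_units (R := R) x
  refine ⟨transposeUnit k₂ * k₁⁻¹,
    Subgroup.mul_mem _ ((transposeUnit_mem_range_iff k₂).mpr hk₂) (Subgroup.inv_mem _ hk₁),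
    k₂⁻¹ * transposeUnit k₁,
    Subgroup.mul_mem _ (Subgroup.inv_mem _ hk₂) ((transposeUnit_mem_range_iff k₁).mpr hk₁), ?_⟩
  ext1
  simp only [Units.val_mul, coe_transposeUnit, hx, Matrix.transpose_mul, Matrix.diagonal_transpose,
    mul_assoc, Units.inv_mul_cancel_left, Units.mul_inv_cancel_left]

/-- The second hypothesis of T5-84, in its orbit form: the coset `xᵀK` lies in the `K`-orbit of
`xK`, i.e. `xᵀ ∈ K x K`. -/
theorem unop_transposeAntiAut_mem_orbit (x : GL ι F) :
    ((unop (transposeAntiAut x) : GL ι F) :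
        GL ι F ⧸ (Matrix.GeneralLinearGroup.map (n := ι) (algebraMap R F)).range) ∈
      MulAction.orbit (Matrix.GeneralLinearGroup.map (n := ι) (algebraMap R F)).range
        (x : GL ι F ⧸ (Matrix.GeneralLinearGroup.map (n := ι) (algebraMap R F)).range) := by
  set K : Subgroup (GL ι F) := (Matrix.GeneralLinearGroup.map (n := ι) (algebraMap R F)).range
    with hK
  obtain ⟨k₁, hk₁, k₂, hk₂, hx⟩ := transposeUnit_eq_mul_mul (R := R) x
  refine MulAction.mem_orbit_iff.mpr ⟨⟨k₁, hk₁⟩, ?_⟩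
  rw [unop_transposeAntiAut, hx]
  change ((k₁ * x : GL ι F) : GL ι F ⧸ K) = ((k₁ * x * k₂ : GL ι F) : GL ι F ⧸ K)
  rw [QuotientGroup.eq, inv_mul_cancel_left]
  exact hk₂

/-- **`H(GL_n(F), GL_n(R))` is commutative** — Gelfand's trick (T5-84, anti-automorphism form)
with `τ = transposition`, the Cartan decomposition supplying `xᵀ ∈ K x K`. The only remaining
hypothesis is the finiteness of every double coset space `KgK/K` (for `K = GL_n(𝒪_v)` compact
open in `GL_n(F_v)` this is the compactness of `K`; it stays a hypothesis here). -/
theorem heckeAlgebra_mul_comm (k : Type*) [Field k]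
    (hfin : ∀ g : GL ι F, Finite (MulAction.orbit
      (Matrix.GeneralLinearGroup.map (n := ι) (algebraMap R F)).range
      (g : GL ι F ⧸ (Matrix.GeneralLinearGroup.map (n := ι) (algebraMap R F)).range)))
    (T S : T5HeckePermutationModule.heckeAlgebra k
      (Matrix.GeneralLinearGroup.map (n := ι) (algebraMap R F)).range) :
    T * S = S * T :=
  T5HeckeGelfandTrickGeneral.mul_comm_of_antiAut hfin transposeAntiAut
    (fun x => unop_transposeAntiAut_mem_iff (R := R) x)
    (fun x => unop_transposeAntiAut_mem_orbit (R := R) x) T S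

end Integral

end Summit.Ventures.HodgeRepro2.T5CartanTransposeGelfand
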